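import Summits.CriticalPhenomena.PercolationContinuityZ3.Theorems.PercNearOneGluingNoHeavyLowerTailQuantitativeBHKGlauber
import Summits.CriticalPhenomena.PercolationContinuityZ3.Theorems.PercNearOneGluingNoHeavyLowerTailQuantitativeBHKRepulsion
import Summits.CriticalPhenomena.PercolationContinuityZ3.Theorems.PercNearOneGluingNoHeavyLowerTailCoreConditioning
import HarnessLib

/-!
# Quantitative BHK Thm 1.4 for an avoided SET: `C_s` versus every increasing functional off `C̄_s`, with the Glauber floor

Support file (`--supports stmt-CriticalPhenomena-4575`), prover seat `prim-rate-mine-2` (lane prim-rate, constants-miner (c); set form of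
BENCH row M2-R9 for the level-`t` CSH / (S5) margins, where the conditioning is `v ↮ T` with `T` a SET).  No definitions, no named
facts, no sorries; standard axioms.

For `D = {s ↮ X}` (`X ⊆ V` arbitrary), `F` an increasing function of the vertex set of `C_s`, and `K` ANY increasing function of bond
configurations, evaluated OFF the pairs meeting `C_s` (`K(ω ∖ A(C_s))`, `A(W)` = the pairs meeting `W`; e.g. `K = 1{t ↔ o}` or `G(C_t)`
with `t ∈ X`, for which `K(ω ∖ A(C_s)) = K(ω)` on `D`), BHK's domain Markov property (display (10); tree
`CoreConditioning.sum_cond_cluster_off`) gives `E[F(C_s)·K(ω ∖ A(C_s)); D] = E[F(C_s)·Ψ_K(C_s); D]` with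
`Ψ_K(W) = ∫ K(η ∖ A(W)) dμ(η)` antitone in `W` (`setIntegral_mul_offCluster_eq_condexp`, `condexp_offCluster_antitone`), and the lane's
quantitative Thm 1.3 (`QuantBHK.condCov_ge_glauberTerm`, the Glauber floor) applied to `(F, −Ψ_K)` yields

  `(∫_D F(C_s))·(∫_D K(ω∖A(C_s))) − μ(D)·∫_D F(C_s)·K(ω∖A(C_s)) ≥ μ(D)·w_e(1−w_e)·∫ 1_D(ω∪e)·ΔF·(Ψ_K(C_s(ω∖e)) − Ψ_K(C_s(ω∪e))) dμ ≥ 0`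

for EVERY pair `e` (`QuantBHK.offCluster_negCov_ge_glauberTerm`): given `s ↮ X`, the cluster of `s` is negatively correlated with every
increasing functional of the configuration outside it, quantitatively.
[cite: VandenbergHaggstromKahn2005, Thm. 1.3 (p. 6), Thm. 1.4 and display (10) (p. 7)]
-/

noncomputable section

open MeasureTheory Set Literature.Probability.LatticeModels
open Literature.Probability.LatticeModels (prodBernoulli)

namespace Summit.CriticalPhenomena.PercolationContinuityZ3.Theorems

namespace QuantBHK

open Literature.Probability.Percolation Literature.Probability.Percolation.BHK2006
open scoped Classical
open DecisionTree (ind ind_of_mem ind_of_not_mem ind_nonneg)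

variable {V : Type*} [Fintype V]

/-- **Display (10), avoided-set / off-cluster form**: on `D = {s ↮ X}`,
`∫_D F(C_s)·K(ω ∖ A(C_s)) dμ = ∫_D F(C_s)·(∫ K(η ∖ A(C_s(ω))) dμ(η)) dμ(ω)`, `A(W)` = the pairs meeting `W`.
[cite: VandenbergHaggstromKahn2005, display (10) (p. 7)] -/
theorem setIntegral_mul_offCluster_eq_condexp (w : Sym2 V → unitInterval) (s : V) (X : Set V) (F : Set V → ℝ)
    (K : Set (Sym2 V) → ℝ) :
    ∫ ω in {ω : BondConfig V | ∀ x ∈ X, ¬ (openGraph ω).Reachable s x},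
        F (openCluster ω s) * K (ω \ {f | ∃ u ∈ openCluster ω s, u ∈ f}) ∂(prodBernoulli w) =
      ∫ ω in {ω : BondConfig V | ∀ x ∈ X, ¬ (openGraph ω).Reachable s x},
        F (openCluster ω s) *
          (∫ η, K (η \ {f | ∃ u ∈ openCluster ω s, u ∈ f}) ∂(prodBernoulli w)) ∂(prodBernoulli w) := by
  set w' : Sym2 V → ℝ := fun f => (w f : ℝ) with hw'
  have hm : ∑ ω, weight w' ω = 1 := by
    have h1 := integral_prodBernoulli_eq_sum w fun _ => (1 : ℝ)
    simp only [integral_const, probReal_univ, smul_eq_mul, mul_one] at h1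
    exact h1.symm
  set vs : Set (Sym2 V) → Set V := fun C => {a : V | a = s ∨ ∃ e' ∈ C, a ∈ e'} with hvs
  have hvsC : ∀ ζ : BondConfig V, vs (openEdgeCluster ζ s) = openCluster ζ s := fun ζ => by
    rw [KNPreFKG.openCluster_eq_setOf_openEdgeCluster]
  set D : Set (BondConfig V) := {ω : BondConfig V | ∀ x ∈ X, ¬ (openGraph ω).Reachable s x} with hD
  set D' : Set (Set (Sym2 V)) := {C | ∀ x ∈ X, x ∉ vs C} with hD'
  have hDC : ∀ ζ : BondConfig V, ind D' (openEdgeCluster ζ s) = ind D ζ := by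
    intro ζ
    by_cases h : ζ ∈ D
    · rw [ind_of_mem h, ind_of_mem]
      show ∀ x ∈ X, x ∉ vs (openEdgeCluster ζ s)
      rw [hvsC]; exact h
    · rw [ind_of_not_mem h, ind_of_not_mem]
      show ¬ ∀ x ∈ X, x ∉ vs (openEdgeCluster ζ s)
      rw [hvsC]; exact h
  set K' : Set (Sym2 V) → Set (Sym2 V) → ℝ := fun C θ => F (vs C) * ind D' C * K θ with hK'
  have key := CoreConditioning.sum_cond_cluster_off w' hm s K'
  have hA : ∀ ω : BondConfig V, {e : Sym2 V | ∃ v ∈ e, v = s ∨ ∃ e' ∈ openEdgeCluster ω s, v ∈ e'} =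
      {f | ∃ u ∈ openCluster ω s, u ∈ f} := by
    intro ω
    ext f
    rw [← hvsC]
    simp only [hvs, Set.mem_setOf_eq]
    constructor
    · rintro ⟨v, hv, h⟩; exact ⟨v, h, hv⟩
    · rintro ⟨u, h, hu⟩; exact ⟨u, hu, h⟩
  simp_rw [hA] at key
  rw [setIntegral_eq_sum_weight, setIntegral_eq_sum_weight]
  have hl : ∀ ω : BondConfig V,
      F (openCluster ω s) * K (ω \ {f | ∃ u ∈ openCluster ω s, u ∈ f}) * ind D ω =
        K' (openEdgeCluster ω s) (ω \ {f | ∃ u ∈ openCluster ω s, u ∈ f}) := by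
    intro ω
    simp only [hK', hvsC, hDC]
    ring
  have hr : ∀ ω : BondConfig V,
      F (openCluster ω s) * (∫ η, K (η \ {f | ∃ u ∈ openCluster ω s, u ∈ f}) ∂(prodBernoulli w)) * ind D ω =
        ∑ η, weight w' η * K' (openEdgeCluster ω s) (η \ {f | ∃ u ∈ openCluster ω s, u ∈ f}) := by
    intro ω
    have hL : F (openCluster ω s) * (∫ η, K (η \ {f | ∃ u ∈ openCluster ω s, u ∈ f}) ∂(prodBernoulli w)) * ind D ω =
        ∑ η, weight w' η * (F (openCluster ω s) * ind D ω * K (η \ {f | ∃ u ∈ openCluster ω s, u ∈ f})) := by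
      rw [integral_prodBernoulli_eq_sum, Finset.mul_sum, Finset.sum_mul]
      refine Finset.sum_congr rfl fun η _ => ?_
      ring
    rw [hL]
    refine Finset.sum_congr rfl fun η _ => ?_
    simp only [hK', hvsC, hDC]
  simp_rw [hl, hr]
  exact key

omit [Fintype V] in
/-- `A(W)` = the pairs meeting `W` is monotone in `W`, so `η ∖ A(W)` is antitone. [folklore] -/
theorem sdiff_meeting_antitone (η : Set (Sym2 V)) :
    Antitone fun W : Set V => η \ {f : Sym2 V | ∃ u ∈ W, u ∈ f} := by
  intro W W' hWW'
  refine Set.sdiff_subset_sdiff_right ?_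
  rintro f ⟨u, hu, huf⟩
  exact ⟨u, hWW' hu, huf⟩

/-- `Ψ_K(W) = ∫ K(η ∖ A(W)) dμ(η)` is antitone in `W` for increasing `K`. [folklore] -/
theorem condexp_offCluster_antitone (w : Sym2 V → unitInterval) (K : Set (Sym2 V) → ℝ) (hK : Monotone K) :
    Antitone fun W : Set V => ∫ η, K (η \ {f : Sym2 V | ∃ u ∈ W, u ∈ f}) ∂(prodBernoulli w) := by
  intro W W' hWW'
  simp only [integral_prodBernoulli_eq_sum]
  exact Finset.sum_le_sum fun η _ => mul_le_mul_of_nonneg_left (hK (sdiff_meeting_antitone η hWW'))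
    (weight_nonneg (fun f => (w f).2.1) (fun f => (w f).2.2) η)

/-- **Quantitative BHK Thm 1.4, avoided-set / off-cluster form, with the Glauber floor.**  `D = {s ↮ X}`, `F` increasing on vertex
sets, `K` increasing on configurations, `A(W)` = pairs meeting `W`, `Ψ_K(W) = ∫ K(η ∖ A(W)) dμ(η)`, `e` any pair:
  `μ(D)·w_e(1−w_e)·∫ 1_D(ω∪e)·(F(C_s(ω∪e)) − F(C_s(ω∖e)))·(Ψ_K(C_s(ω∖e)) − Ψ_K(C_s(ω∪e))) dμ`
  `≤ (∫_D F(C_s))·(∫_D K(ω∖A(C_s))) − μ(D)·∫_D F(C_s)·K(ω∖A(C_s))`,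
i.e. `−Cov_ν(F(C_s), K(ω ∖ A(C_s))) ≥ E_ν[Cov_ν(F, −Ψ_K | ω off e)] ≥ 0` for `ν = μ(·|s↮X)`.
[cite: VandenbergHaggstromKahn2005, Thm. 1.3 (p. 6), Thm. 1.4 and display (10) (p. 7)] -/
theorem offCluster_negCov_ge_glauberTerm (w : Sym2 V → unitInterval) (s : V) (X : Set V) (e : Sym2 V) (F : Set V → ℝ)
    (K : Set (Sym2 V) → ℝ) (hF : Monotone F) (hK : Monotone K) :
    (prodBernoulli w).real {ω : BondConfig V | ∀ x ∈ X, ¬ (openGraph ω).Reachable s x} *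
        ((w e : ℝ) * (1 - w e) *
          ∫ ω, ({ω : BondConfig V | ∀ x ∈ X, ¬ (openGraph ω).Reachable s x}).indicator (fun _ => (1 : ℝ)) (insert e ω) *
            ((F (openCluster (insert e ω) s) - F (openCluster (ω \ {e}) s)) *
              ((∫ η, K (η \ {f | ∃ u ∈ openCluster (ω \ {e}) s, u ∈ f}) ∂(prodBernoulli w)) -
                (∫ η, K (η \ {f | ∃ u ∈ openCluster (insert e ω) s, u ∈ f}) ∂(prodBernoulli w))))
            ∂(prodBernoulli w)) ≤
      (∫ ω in {ω : BondConfig V | ∀ x ∈ X, ¬ (openGraph ω).Reachable s x}, F (openCluster ω s) ∂(prodBernoulli w)) *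
          (∫ ω in {ω : BondConfig V | ∀ x ∈ X, ¬ (openGraph ω).Reachable s x},
            K (ω \ {f | ∃ u ∈ openCluster ω s, u ∈ f}) ∂(prodBernoulli w)) -
        (prodBernoulli w).real {ω : BondConfig V | ∀ x ∈ X, ¬ (openGraph ω).Reachable s x} *
          ∫ ω in {ω : BondConfig V | ∀ x ∈ X, ¬ (openGraph ω).Reachable s x},
            F (openCluster ω s) * K (ω \ {f | ∃ u ∈ openCluster ω s, u ∈ f}) ∂(prodBernoulli w) := by
  set μ := prodBernoulli w with hμ
  set Ψ : Set V → ℝ := fun W => ∫ η, K (η \ {f : Sym2 V | ∃ u ∈ W, u ∈ f}) ∂μ with hΨ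
  have hΨa : Antitone Ψ := condexp_offCluster_antitone w K hK
  have hG' : Monotone fun W => - Ψ W := fun W W' h => neg_le_neg (hΨa h)
  have key := condCov_ge_glauberTerm w s X e F (fun W => - Ψ W) hF hG'
  set D : Set (BondConfig V) := {ω : BondConfig V | ∀ x ∈ X, ¬ (openGraph ω).Reachable s x} with hD
  -- display (10)
  have h10 := setIntegral_mul_offCluster_eq_condexp w s X F K
  have h10' := setIntegral_mul_offCluster_eq_condexp w s X (fun _ => (1 : ℝ)) K
  simp only [one_mul] at h10'
  have i1 : ∫ ω in D, F (openCluster ω s) * (fun W => - Ψ W) (openCluster ω s) ∂μ =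
      - ∫ ω in D, F (openCluster ω s) * K (ω \ {f | ∃ u ∈ openCluster ω s, u ∈ f}) ∂μ := by
    rw [h10, ← integral_neg]
    refine integral_congr_ae (Filter.Eventually.of_forall fun ω => ?_)
    simp only [hΨ]; ring
  have i2 : ∫ ω in D, (fun W => - Ψ W) (openCluster ω s) ∂μ =
      - ∫ ω in D, K (ω \ {f | ∃ u ∈ openCluster ω s, u ∈ f}) ∂μ := by
    rw [h10', ← integral_neg]
  rw [i1, i2] at key
  have eq : ∫ ω, D.indicator (fun _ => (1 : ℝ)) (insert e ω) *
        ((F (openCluster (insert e ω) s) - F (openCluster (ω \ {e}) s)) *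
          (Ψ (openCluster (ω \ {e}) s) - Ψ (openCluster (insert e ω) s))) ∂μ =
      ∫ ω, D.indicator (fun _ => (1 : ℝ)) (insert e ω) *
        ((F (openCluster (insert e ω) s) - F (openCluster (ω \ {e}) s)) *
          ((fun W => - Ψ W) (openCluster (insert e ω) s) - (fun W => - Ψ W) (openCluster (ω \ {e}) s))) ∂μ := by
    refine integral_congr_ae (Filter.Eventually.of_forall fun ω => ?_)
    simp only; ring
  rw [eq]
  linarith [key]

end QuantBHK

end Summit.CriticalPhenomena.PercolationContinuityZ3.Theorems
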